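import Mathlib.Analysis.InnerProductSpace.PiL2
import Mathlib.Data.Fin.Embedding
import Mathlib.Data.Fin.Tuple.Basic
import Mathlib.SetTheory.Cardinal.Finite
import Literature.Geometry.DiscreteGeometry.KissingPatterns
import HarnessLib

/-!
# Line `separation-padding-transfer` (crux `ReggeStarCoercivity.StarCoercivity`, stmt-AtomisticToContinuum-13600):
# the defect count under deletion of one particle

Stub `stub_defectsGlue` of the line skeleton (pure counting glue). For a finite configuration
`x : Fin (N + 1) → ℝ³` call the site `i` GOOD when, for some `a ∈ [9/10, 11/10]`, its recentred `6/5`-shell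
rescaled by `a⁻¹` is `1/20`-close (`ShellCloseTo`) to the fcc or to the hcp kissing pattern, and DEFECTIVE
otherwise. Deleting the particle `i₀` (passing to `x ∘ Fin.succAbove i₀`) raises the number of defective
sites by at most `56`:

`#{i : Fin (N + 1) | ¬ GOOD x i} ≤ #{j : Fin N | ¬ GOOD (x ∘ i₀.succAbove) j} + 56`,

GIVEN the two neighbouring stubs of the line as hypotheses:

* (B, far shells are unchanged) if `6/5 < dist (x (i₀.succAbove j)) (x i₀)` then the recentred rescaled
  `6/5`-shell of `i₀.succAbove j` in `x` equals that of `j` in `x ∘ i₀.succAbove`, for every scale `a`;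
* (C, bounded valence of good sites) at most `55` GOOD sites of any configuration lie within `6/5` of any point.

Proof. Every `i : Fin (N + 1)` is `i₀` or `i₀.succAbove j` (`Fin.eq_self_or_eq_succAbove`). A defective
`i = i₀.succAbove j` with `j` defective in the deleted configuration is counted on the right; if `j` is GOOD
there, then `dist (x i) (x i₀) ≤ 6/5` (otherwise B transports goodness of `j` to `i`), so `j` lies in the set
bounded by C (with `y := x ∘ i₀.succAbove`, `p := x i₀`). Hence
`#Def(x) ≤ 1 + #Def(x ∘ i₀.succAbove) + 55`. The abstract counting step is `natCard_not_le_of_succAbove`.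
All `[folklore]`.
-/

noncomputable section

open scoped Classical

namespace Summit.AtomisticToContinuum.Crystallization.Theorems.SeparationPaddingTransfer

/-- `Nat.card` of a subtype of a finite type cut out by a predicate is the cardinality of the filtered
`Finset.univ`, for any decidability instance (`Nat.card` form of `Fintype.card_subtype`). [folklore] -/
theorem natCard_subtype_eq_card_filter {α : Type*} [Fintype α] (p : α → Prop) [DecidablePred p] :
    Nat.card {a : α // p a} = (Finset.univ.filter p).card :=
  Nat.subtype_card _ fun _ => ⟨fun h => (Finset.mem_filter.1 h).2, fun h => Finset.mem_filter.2 ⟨Finset.mem_univ _, h⟩⟩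

/-- Abstract counting glue. Let `P` be a predicate on `Fin (N + 1)` ("good in `x`"), `Q` a predicate on `Fin N`
("good in the configuration with `i₀` deleted") and `S` a finset of `Fin N` with at most `55` elements that contains
every `j` with `Q j` but `¬ P (i₀.succAbove j)`. Then `#{i | ¬ P i} ≤ #{j | ¬ Q j} + 56`: indeed
`{i | ¬ P i} ⊆ {i₀} ∪ i₀.succAbove '' ({j | ¬ Q j} ∪ S)` because every `i` is `i₀` or some `i₀.succAbove j`
(`Fin.eq_self_or_eq_succAbove`). [folklore] -/
theorem natCard_not_le_of_succAbove {N : ℕ} (i₀ : Fin (N + 1)) (P : Fin (N + 1) → Prop) (Q : Fin N → Prop)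
    (S : Finset (Fin N)) (hS : S.card ≤ 55)
    (hmem : ∀ j : Fin N, ¬ P (Fin.succAbove i₀ j) → Q j → j ∈ S) :
    Nat.card {i : Fin (N + 1) // ¬ P i} ≤ Nat.card {j : Fin N // ¬ Q j} + 56 := by
  rw [natCard_subtype_eq_card_filter (fun i : Fin (N + 1) => ¬ P i),
    natCard_subtype_eq_card_filter (fun j : Fin N => ¬ Q j)]
  have hsub : (Finset.univ.filter fun i : Fin (N + 1) => ¬ P i) ⊆
      insert i₀ (((Finset.univ.filter fun j : Fin N => ¬ Q j) ∪ S).map (Fin.succAboveEmb i₀)) := by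
    intro i hi
    rw [Finset.mem_insert]
    rcases Fin.eq_self_or_eq_succAbove i₀ i with h | ⟨j, rfl⟩
    · exact Or.inl h
    · refine Or.inr (Finset.mem_map.2 ⟨j, ?_, rfl⟩)
      rw [Finset.mem_union]
      by_cases hq : Q j
      · exact Or.inr (hmem j (Finset.mem_filter.1 hi).2 hq)
      · exact Or.inl (Finset.mem_filter.2 ⟨Finset.mem_univ _, hq⟩)
  calc (Finset.univ.filter fun i : Fin (N + 1) => ¬ P i).card
      ≤ (insert i₀ (((Finset.univ.filter fun j : Fin N => ¬ Q j) ∪ S).map (Fin.succAboveEmb i₀))).card :=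
        Finset.card_le_card hsub
    _ ≤ (((Finset.univ.filter fun j : Fin N => ¬ Q j) ∪ S).map (Fin.succAboveEmb i₀)).card + 1 :=
        Finset.card_insert_le _ _
    _ = ((Finset.univ.filter fun j : Fin N => ¬ Q j) ∪ S).card + 1 := by rw [Finset.card_map]
    _ ≤ (Finset.univ.filter fun j : Fin N => ¬ Q j).card + S.card + 1 :=
        Nat.add_le_add_right (Finset.card_union_le _ _) _
    _ ≤ (Finset.univ.filter fun j : Fin N => ¬ Q j).card + 56 := by omega

/-- **Stub `stub_defectsGlue`** of line `separation-padding-transfer` (crux `ReggeStarCoercivity.StarCoercivity`):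
deleting one particle `i₀` of a finite configuration `x : Fin (N + 1) → ℝ³` raises the number of STAR-DEFECTIVE sites
(sites whose recentred `6/5`-shell, rescaled by some `a ∈ [9/10, 11/10]`, is NOT `1/20`-close to the fcc or hcp
kissing pattern) by at most `56`, GIVEN (B) that shells of sites farther than `6/5` from `x i₀` are unchanged by the
deletion and (C) that at most `55` star-good sites of any configuration lie within `6/5` of any point. Pure counting:
a defective site of `x` is `i₀`, or `i₀.succAbove j` with `j` defective after deletion, or `i₀.succAbove j` with `j`
good after deletion and then (B, contrapositive) within `6/5` of `x i₀`, of which (C) there are at most `55`.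
(Injectivity of `x` is not used.) [folklore] -/
theorem stub_defectsGlue : (∀ (N : ℕ) (x : Fin (N + 1) → EuclideanSpace ℝ (Fin 3)) (i₀ : Fin (N + 1)) (j : Fin N) (a : ℝ), 6 / 5 < dist (x (Fin.succAbove i₀ j)) (x i₀) → ((Finset.univ.filter fun k : Fin (N + 1) => k ≠ Fin.succAbove i₀ j ∧ dist (x (Fin.succAbove i₀ j)) (x k) ≤ 6 / 5).image fun k => a⁻¹ • (x k - x (Fin.succAbove i₀ j))) = ((Finset.univ.filter fun k : Fin N => k ≠ j ∧ dist (x (Fin.succAbove i₀ j)) (x (Fin.succAbove i₀ k)) ≤ 6 / 5).image fun k => a⁻¹ • (x (Fin.succAbove i₀ k) - x (Fin.succAbove i₀ j)))) → (∀ (N : ℕ) (y : Fin N → EuclideanSpace ℝ (Fin 3)) (p : EuclideanSpace ℝ (Fin 3)), ((Finset.univ.filter fun i : Fin N => dist (y i) p ≤ 6 / 5 ∧ ∃ a : ℝ, 9 / 10 ≤ a ∧ a ≤ 11 / 10 ∧ (Literature.Geometry.DiscreteGeometry.ShellCloseTo (1 / 20) ((Finset.univ.filter fun j : Fin N => j ≠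 i ∧ dist (y i) (y j) ≤ 6 / 5).image fun j => a⁻¹ • (y j - y i)) Literature.Geometry.DiscreteGeometry.fccKissingPattern ∨ Literature.Geometry.DiscreteGeometry.ShellCloseTo (1 / 20) ((Finset.univ.filter fun j : Fin N => j ≠ i ∧ dist (y i) (y j) ≤ 6 / 5).image fun j => a⁻¹ • (y j - y i)) Literature.Geometry.DiscreteGeometry.hcpKissingPattern))).card ≤ 55) → ∀ (N : ℕ) (x : Fin (N + 1) → EuclideanSpace ℝ (Fin 3)) (i₀ : Fin (N + 1)), Function.Injective x → Nat.card {i : Fin (N + 1) // ¬ ∃ a : ℝ, 9 / 10 ≤ a ∧ a ≤ 11 / 10 ∧ (Literature.Geometry.DiscreteGeometry.ShellCloseTo (1 / 20) ((Finset.univ.filter fun j : Fin (N + 1) => j ≠ i ∧ dist (x i) (x j) ≤ 6 / 5).image fun j => a⁻¹ • (x j - x i)) Literature.Geometry.DiscreteGeometry.fccKissingPattern ∨ Literature.Geometry.DiscreteGeometry.ShellCloseTo (1 / 20) ((Finset.univ.filter fun j : Fin (N + 1) => j ≠ i ∧ dist (x i) (x j) ≤ 6 / 5).image fun j => a⁻¹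 • (x j - x i)) Literature.Geometry.DiscreteGeometry.hcpKissingPattern)} ≤ Nat.card {i : Fin N // ¬ ∃ a : ℝ, 9 / 10 ≤ a ∧ a ≤ 11 / 10 ∧ (Literature.Geometry.DiscreteGeometry.ShellCloseTo (1 / 20) ((Finset.univ.filter fun j : Fin N => j ≠ i ∧ dist (x (Fin.succAbove i₀ i)) (x (Fin.succAbove i₀ j)) ≤ 6 / 5).image fun j => a⁻¹ • (x (Fin.succAbove i₀ j) - x (Fin.succAbove i₀ i))) Literature.Geometry.DiscreteGeometry.fccKissingPattern ∨ Literature.Geometry.DiscreteGeometry.ShellCloseTo (1 / 20) ((Finset.univ.filter fun j : Fin N => j ≠ i ∧ dist (x (Fin.succAbove i₀ i)) (x (Fin.succAbove i₀ j)) ≤ 6 / 5).image fun j => a⁻¹ • (x (Fin.succAbove i₀ j) - x (Fin.succAbove i₀ i))) Literature.Geometry.DiscreteGeometry.hcpKissingPattern)} + 56 := by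
  intro hB hC N x i₀ _hx
  refine natCard_not_le_of_succAbove i₀ _ _ _ (hC N (fun k => x (Fin.succAbove i₀ k)) (x i₀)) ?_
  intro j hP hQ
  refine Finset.mem_filter.2 ⟨Finset.mem_univ _, ?_, hQ⟩
  by_contra hfar
  apply hP
  obtain ⟨a, ha, ha', h⟩ := hQ
  refine ⟨a, ha, ha', ?_⟩
  rw [hB N x i₀ j a (not_le.mp hfar)]
  exact h

end Summit.AtomisticToContinuum.Crystallization.Theorems.SeparationPaddingTransfer
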